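import Mathlib
import Literature.NumberTheory.DiophantineGeometry.AbcWave0
import Literature.NumberTheory.DiophantineGeometry.GeneralizedFermatSignatureNN2
import Literature.NumberTheory.DiophantineGeometry.GeneralizedFermatSignatureNN3

/-!
# Family L4 of the three-prime zoo is empty modulo Darmon–Merel (PROVED-MOD-FACTS ≠ proved)

Support for `SolvedZooABC` (stmt-ABC-24025, `route-ABC-ThreeSlotCyclotomicDescent`), using ONLY
named facts ALREADY in the tree, entering as explicit hypotheses by name (never restated):
`Literature.NumberTheory.DiophantineGeometry.darmonMerel1997_sumOfPowersEqSquare`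
([DarmonMerel1997] Main Theorem (2), `xⁿ + yⁿ = z²`, `n ≥ 4`; unconditional as printed) and
`Literature.NumberTheory.DiophantineGeometry.darmonMerel1997_sumOfPowersEqCube`
([DarmonMerel1997] Main Theorem (3), `xⁿ + yⁿ = z³`, `n ≥ 3`; PRINTED UNDER THE MODULARITY
HYPOTHESIS — since discharged by [BreuilConradDiamondTaylor2001], but the cite is as printed).
Both are cited facts, UNPROVED in the tree.

Family L4 of the route statement is the consecutive-base shape `A^l + q^y = (A+1)^l` with `q`
prime, `l ≥ 5`, `y ≥ 2` and `2 ∣ y ∨ 3 ∣ y`. It is EMPTY modulo the two facts (`l4_empty`):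

* even `l = 2m` — ELEMENTARY AND UNCONDITIONAL: `((A+1)^m − A^m)((A+1)^m + A^m) = q^y` with both
  factors odd and `> 1`, so `q` divides both, hence `q ∣ A` and `q ∣ A + 1` — impossible
  (`consecutive_even_pow_ne_prime_pow`);
* odd `l`, `2 ∣ y` — `(A+1)^l + (−A)^l = (q^{y/2})²` is a primitive (`gcd(A+1, A) = 1`) non-trivial
  (`A ≥ 1`, `q ≥ 2`) solution of `xⁿ + yⁿ = z²` with `n = l ≥ 5 ≥ 4`, excluded by Main Theorem (2);
* odd `l`, `3 ∣ y` — likewise `… = (q^{y/3})³` with `n = l ≥ 3`, excluded by Main Theorem (3).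

Hence `SolvedZooABC` restricted to L4 (both orientations) holds — vacuously — modulo the two facts
(`solvedZoo_L4`). HONESTY: stmt-ABC-24025 `SolvedZooABC` remains ONE open MOD-FACT item; this file
discharges its L4 conjunct only, leaving L1 (`x² + 2^k = yⁿ`), L2 (`x² + 1 = 2y⁴` / Pell perfect
powers), L3 (Ljunggren 1943) with their print theorems not in the tree. None of this is abc or the
cell B₃; PROVED-MOD-FACTS ≠ proved; abc is not proved.
-/

namespace Summit.ABC.ABC.Theorems.ThreeSlotL4Empty

open Literature.NumberTheory.DiophantineGeometry (IsABCTriple rad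
  darmonMerel1997_sumOfPowersEqSquare darmonMerel1997_sumOfPowersEqCube)

/-- `(A+1)^m ≥ A^m + 2` for `A ≥ 1`, `m ≥ 2`. -/
theorem pow_succ_base_ge {A m : ℕ} (hA : 1 ≤ A) (hm : 2 ≤ m) : A ^ m + 2 ≤ (A + 1) ^ m := by
  obtain ⟨t, rfl⟩ : ∃ t, m = t + 2 := ⟨m - 2, by omega⟩
  have h1 : A ^ t ≤ (A + 1) ^ t := Nat.pow_le_pow_left (by omega) t
  have h2 : 1 ≤ A ^ t := Nat.one_le_pow _ _ (by omega)
  rw [pow_add, pow_add]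
  nlinarith

/-- **Even exponent, elementary**: `A^(2m) + q^y = (A+1)^(2m)` is impossible for `q` prime,
`A ≥ 1`, `m ≥ 2` — the two coprime odd factors `(A+1)^m ∓ A^m` of `q^y` are both `> 1`. -/
theorem consecutive_even_pow_ne_prime_pow {A m q y : ℕ} (hq : q.Prime) (hA : 1 ≤ A) (hm : 2 ≤ m) :
    A ^ (2 * m) + q ^ y ≠ (A + 1) ^ (2 * m) := by
  intro h
  rw [mul_comm 2 m, pow_mul, pow_mul] at h
  set U := (A + 1) ^ m with hU
  set V := A ^ m with hV
  have hVU : V + 2 ≤ U := pow_succ_base_ge hA hm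
  have hqy : q ^ y = (U + V) * (U - V) := by rw [← Nat.sq_sub_sq]; omega
  -- both factors are powers of `q`, both `> 1`, hence both divisible by `q`
  have hd1 : U - V ∣ q ^ y := hqy ▸ dvd_mul_left _ _
  have hd2 : U + V ∣ q ^ y := hqy ▸ dvd_mul_right _ _
  obtain ⟨i, -, hi⟩ := (Nat.dvd_prime_pow hq).mp hd1
  obtain ⟨j, -, hj⟩ := (Nat.dvd_prime_pow hq).mp hd2
  have hi1 : 1 ≤ i := by
    by_contra hi0
    have : i = 0 := by omega
    subst this
    rw [pow_zero] at hi
    omega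
  have hj1 : 1 ≤ j := by
    by_contra hj0
    have : j = 0 := by omega
    subst this
    rw [pow_zero] at hj
    omega
  have hq1 : q ∣ U - V := hi ▸ dvd_pow_self q (by omega)
  have hq2 : q ∣ U + V := hj ▸ dvd_pow_self q (by omega)
  -- `U + V` is odd (consecutive bases), so `q` is odd
  have hodd : Odd (U + V) := by
    rcases Nat.even_or_odd A with hAe | hAo
    · have hVe : Even V := by rw [hV]; exact (Nat.even_pow' (by omega)).mpr hAe
      have hUo : Odd U := by rw [hU]; exact (hAe.add_one).pow
      exact Odd.add_even hUo hVe
    · have hVo : Odd V := by rw [hV]; exact hAo.pow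
      have hUe : Even U := by rw [hU]; exact (Nat.even_pow' (by omega)).mpr (hAo.add_one)
      exact Even.add_odd hUe hVo
  have hq2' : q ≠ 2 := by
    rintro rfl
    exact hodd.not_two_dvd_nat hq2
  have hqodd : Odd q := hq.eq_two_or_odd'.resolve_left hq2'
  -- `q ∣ 2V` and `q ∣ 2U`, hence `q ∣ V`, `q ∣ U`
  have h2V : q ∣ 2 * V := by
    have : U + V = (U - V) + 2 * V := by omega
    rw [this] at hq2
    exact (Nat.dvd_add_right hq1).mp hq2
  have h2U : q ∣ 2 * U := by
    have : 2 * U = (U + V) + (U - V) := by omega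
    rw [this]
    exact dvd_add hq2 hq1
  have hqV : q ∣ V := (Nat.Coprime.dvd_of_dvd_mul_left
    ((Nat.coprime_primes hq Nat.prime_two).mpr hq2') h2V)
  have hqU : q ∣ U := (Nat.Coprime.dvd_of_dvd_mul_left
    ((Nat.coprime_primes hq Nat.prime_two).mpr hq2') h2U)
  have hqA1 : q ∣ A + 1 := hq.dvd_of_dvd_pow (hU ▸ hqU)
  have hqA : q ∣ A := hq.dvd_of_dvd_pow (hV ▸ hqV)
  have : q ∣ 1 := (Nat.dvd_add_right hqA).mp hqA1
  exact hq.one_lt.ne' (Nat.dvd_one.mp this)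

/-- The product `(A+1)·(−A)·z` of a would-be Darmon–Merel solution is `≤ −4`, so not trivial. -/
theorem not_trivial {A : ℕ} {z : ℤ} (hA : 1 ≤ A) (hz : 2 ≤ z) :
    ¬ (((A : ℤ) + 1) * (-(A : ℤ)) * z = 0 ∨ ((A : ℤ) + 1) * (-(A : ℤ)) * z = 1 ∨
      ((A : ℤ) + 1) * (-(A : ℤ)) * z = -1) := by
  have hA' : (1 : ℤ) ≤ A := by exact_mod_cast hA
  have h1 : (2 : ℤ) ≤ ((A : ℤ) + 1) * A := by nlinarith
  have h4 : 4 ≤ ((A : ℤ) + 1) * A * z := by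
    nlinarith [mul_le_mul h1 hz (by norm_num : (0 : ℤ) ≤ 2) (by linarith)]
  have e : ((A : ℤ) + 1) * (-(A : ℤ)) * z = -(((A : ℤ) + 1) * A * z) := by ring
  rw [e]
  omega

/-- The gcd condition of the Darmon–Merel facts for `(A+1, −A, z)`. -/
theorem gcd_consecutive (A : ℕ) (z : ℤ) : Int.gcd (Int.gcd ((A : ℤ) + 1) (-(A : ℤ))) z = 1 := by
  have h : Int.gcd ((A : ℤ) + 1) (-(A : ℤ)) = 1 := by
    rw [Int.gcd_neg]
    have : Int.gcd ((A + 1 : ℕ) : ℤ) (A : ℤ) = Nat.gcd (A + 1) A := Int.gcd_natCast_natCast _ _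
    push_cast at this
    rw [this]
    have : Nat.Coprime (A + 1) A := by
      rw [Nat.coprime_self_add_left]
      exact Nat.coprime_one_left A
    exact this
  rw [h]
  exact Int.gcd_one_left z

/-- **Family L4 is empty modulo Darmon–Merel.** For `q` prime, `l ≥ 5`, `y ≥ 2` with `2 ∣ y` or
`3 ∣ y`: `A^l + q^y ≠ (A+1)^l`. Hypotheses: [DarmonMerel1997, Main Theorem (2)] and
[DarmonMerel1997, Main Theorem (3)] as the tree's named facts. -/
theorem l4_empty (h₂ : darmonMerel1997_sumOfPowersEqSquare) (h₃ : darmonMerel1997_sumOfPowersEqCube) :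
    ∀ A l q y : ℕ, q.Prime → 5 ≤ l → 2 ≤ y → (2 ∣ y ∨ 3 ∣ y) → A ^ l + q ^ y ≠ (A + 1) ^ l := by
  intro A l q y hq hl hy hdy h
  rcases Nat.eq_zero_or_pos A with rfl | hA
  · rw [zero_add, one_pow, zero_pow (by omega : l ≠ 0), zero_add] at h
    rcases Nat.pow_eq_one.mp h with h1 | h1
    · exact hq.one_lt.ne' h1
    · omega
  rcases Nat.even_or_odd l with ⟨m, hm⟩ | hlodd
  · exact consecutive_even_pow_ne_prime_pow (m := m) (y := y) hq hA (by omega)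
      (by rw [two_mul, ← hm]; exact h)
  -- odd `l`: a signed solution of `xˡ + yˡ = q^y`
  have key : ((A : ℤ) + 1) ^ l + (-(A : ℤ)) ^ l = (q : ℤ) ^ y := by
    rw [Odd.neg_pow hlodd]
    have := congrArg (Nat.cast : ℕ → ℤ) h
    push_cast at this
    linarith
  rcases hdy with ⟨k, rfl⟩ | ⟨k, rfl⟩
  · -- `y = 2k`: a square
    have hk : 1 ≤ k := by omega
    rw [pow_mul'] at key
    have hz : (2 : ℤ) ≤ (q : ℤ) ^ k := by
      have : 2 ≤ q ^ k := le_trans hq.two_le (Nat.le_self_pow (by omega) q)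
      exact_mod_cast this
    exact not_trivial hA hz (h₂ l (by omega) _ _ _ (gcd_consecutive A _) key)
  · -- `y = 3k`: a cube
    have hk : 1 ≤ k := by omega
    rw [pow_mul'] at key
    have hz : (2 : ℤ) ≤ (q : ℤ) ^ k := by
      have : 2 ≤ q ^ k := le_trans hq.two_le (Nat.le_self_pow (by omega) q)
      exact_mod_cast this
    exact not_trivial hA hz (h₃ l (by omega) _ _ _ (gcd_consecutive A _) key)

/-- **`SolvedZooABC` restricted to family L4 (both orientations), modulo Darmon–Merel** — vacuous,
since the family is empty (`l4_empty`). [DarmonMerel1997, Main Theorem (2), (3)] -/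
theorem solvedZoo_L4 (h₂ : darmonMerel1997_sumOfPowersEqSquare)
    (h₃ : darmonMerel1997_sumOfPowersEqCube) :
    ∀ ε : ℝ, 0 < ε → ∃ C : ℝ, 0 < C ∧ ∀ a b c : ℕ, IsABCTriple a b c →
      ((∃ A l q y : ℕ, q.Prime ∧ 5 ≤ l ∧ 2 ≤ y ∧ (2 ∣ y ∨ 3 ∣ y) ∧ a = A ^ l ∧ b = q ^ y ∧
          c = (A + 1) ^ l) ∨
       (∃ A l q y : ℕ, q.Prime ∧ 5 ≤ l ∧ 2 ≤ y ∧ (2 ∣ y ∨ 3 ∣ y) ∧ b = A ^ l ∧ a = q ^ y ∧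
          c = (A + 1) ^ l)) →
      (c : ℝ) < C * ((rad a b c : ℕ) : ℝ) ^ (1 + ε) := by
  intro ε _
  refine ⟨1, one_pos, ?_⟩
  rintro a b c ht (⟨A, l, q, y, hq, hl, hy, hdy, rfl, rfl, rfl⟩ | ⟨A, l, q, y, hq, hl, hy, hdy, rfl, rfl, rfl⟩)
  · exact absurd ht.2.2.1 (l4_empty h₂ h₃ A l q y hq hl hy hdy)
  · exact absurd ((add_comm _ _).trans ht.2.2.1) (l4_empty h₂ h₃ A l q y hq hl hy hdy)

end Summit.ABC.ABC.Theorems.ThreeSlotL4Empty
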